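import Literature.Barriers.ABC.NoArithmeticDerivative
import HarnessLib

/-!
# Small independent arithmetic derivatives exist (Pasten, Lemma 3.5) — proofs

Sibling proof file of `NoArithmeticDerivative.lean` (D-0014); no new definitions, no new named
facts. It discharges the named fact `Literature.Barriers.ABC.Pasten.exists_adapted_independent`
[cite: Pasten2021, Lemma 3.5]: for coprime positive `a, b` with `(a, b) ≠ (1, 1)` and `c = a + b`
there is a derivation `ψ ∈ 𝒯(a,b)` (supported on the primes of `abc`, with
`d^ψ(a + b) = d^ψ a + d^ψ b`) such that `a, b` are `ψ`-independent (`W^ψ(a,b) = a d^ψ b − b d^ψ a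
≠ 0`) and `‖ψ‖ ≤ ω(abc)/(2 log 2) · c log c`.

## The printed proof and the proof given here

Pasten deduces Lemma 3.5 from Theorem 2.6 (the Bombieri–Vaaler Siegel lemma applied to the one
homogeneous linear equation (EqnAdd) defining `𝒯(a,b)`, which yields `ω(abc) − 1` independent
derivations with `∏ ‖ψᵢ‖ ≤ ω(abc)/(2 log 2) · c log c`) and Lemma 2.9 (they cannot all be
dependent) [cite: Pasten2021, §2.3 Thm. 2.6, §2.4 Lemma 2.9, §3.3 Lemma 3.5]. The EXISTENCE
statement recorded in the named fact needs no geometry of numbers: the two-prime derivation of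
Pasten's Example 3.6 [cite: Pasten2021, Example 3.6] works for every triple. After swapping
`a, b` if `b = 1`, pick a prime `p ∣ b` and a prime `q ∣ c`; put
`ψ(ξ_p) = (c/q) · v_q(c)`, `ψ(ξ_q) = (b/p) · v_p(b)` and `ψ(ξ_r) = 0` otherwise. Since `a, b, c`
are pairwise coprime, `d^ψ a = 0` and `d^ψ b = d^ψ c = b c v_p(b) v_q(c) / (p q)`, so
`ψ ∈ 𝒯(a,b)` and `W^ψ(a,b) = a · d^ψ b ≠ 0`; and `‖ψ‖ ≤ c · log₂ c = 2/(2 log 2) · c log c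
≤ ω(abc)/(2 log 2) · c log c` because `v_q(c) ≤ log₂ c`, `c/q ≤ c` and `ω(abc) ≥ #{p, q} = 2`.
(On the Mersenne triples `1 + (2ⁿ − 1) = 2ⁿ` this `ψ` is the generator `ψ₁` of `𝒯(1, q)` of
Example 3.6, where Pasten's bound is attained up to the factor `2`.)

Main result: `Literature.Barriers.ABC.Pasten.exists_adapted_independent_holds`.
-/

namespace Literature.Barriers.ABC.Pasten

open Literature.NumberTheory.DiophantineGeometry

/-- If `ψ` vanishes at every prime factor of `n` other than `s`, then
`d^ψ n = n · v_s(n) ψ(ξ_s) / s` (one term of Pasten's `d^ψ(n) = n Σ_{p∣n} v_p(n) p⁻¹ ψ(ξ_p)`).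
[cite: Pasten2021, §2.1 (proof of Lemma 2.2)] -/
theorem arithDerivWith_eq_single (ψ : ℕ → ℤ) (n s : ℕ)
    (h : ∀ r : ℕ, r.Prime → r ∣ n → r ≠ s → ψ r = 0) :
    arithDerivWith ψ n = (n : ℚ) * ((n.factorization s : ℚ) * (ψ s : ℚ) / (s : ℚ)) := by
  unfold arithDerivWith
  congr 1
  unfold Finsupp.sum
  rw [Finset.sum_eq_single s]
  · intro r hr hrs
    rw [Nat.support_factorization, Nat.mem_primeFactors] at hr
    simp [h r hr.1 hr.2.1 hrs]
  · intro hs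
    rw [Finsupp.mem_support_iff, not_not] at hs
    simp [hs]

/-- For `m ≠ 0` and `s ≥ 2`: `(m / s) · v_s(m) ≤ m log m / log 2`, since
`2^{v_s(m)} ≤ s^{v_s(m)} ≤ m` and `m / s ≤ m`. [folklore] -/
theorem cast_div_mul_factorization_le {m s : ℕ} (hm : m ≠ 0) (hs : 2 ≤ s) :
    ((m / s * m.factorization s : ℕ) : ℝ) ≤ (m : ℝ) * Real.log m / Real.log 2 := by
  have hlog2 : 0 < Real.log 2 := Real.log_pos one_lt_two
  have h1 : ((m / s : ℕ) : ℝ) ≤ m := by exact_mod_cast Nat.div_le_self m s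
  have h2 : (m.factorization s : ℝ) * Real.log 2 ≤ Real.log m := by
    have hpow : (2 : ℝ) ^ m.factorization s ≤ m := by
      have h := Nat.ordProj_le s hm
      have h' : 2 ^ m.factorization s ≤ s ^ m.factorization s := Nat.pow_le_pow_left hs _
      exact_mod_cast h'.trans h
    have := Real.log_le_log (by positivity) hpow
    rwa [Real.log_pow] at this
  rw [le_div_iff₀ hlog2]
  push_cast
  calc ((m / s : ℕ) : ℝ) * (m.factorization s : ℝ) * Real.log 2
      = ((m / s : ℕ) : ℝ) * ((m.factorization s : ℝ) * Real.log 2) := by ring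
    _ ≤ (m : ℝ) * Real.log m :=
        mul_le_mul h1 h2 (mul_nonneg (Nat.cast_nonneg _) hlog2.le) (Nat.cast_nonneg _)

/-- `𝒯(a,b) = 𝒯(b,a)`: the defining conditions are symmetric in `a, b`.
[cite: Pasten2021, §2.2] -/
theorem IsAdapted.symm {ψ : ℕ → ℤ} {a b : ℕ} (h : IsAdapted ψ a b) : IsAdapted ψ b a := by
  obtain ⟨h1, h2⟩ := h
  refine ⟨fun p hp => ?_, ?_⟩
  · obtain ⟨hpr, hdvd⟩ := h1 p hp
    exact ⟨hpr, by rw [mul_comm b a, add_comm b a]; exact hdvd⟩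
  · rw [add_comm b a, h2, add_comm]

/-- `W^ψ(b,a) = −W^ψ(a,b)` (antisymmetry of the `2 × 2` determinant). [cite: Pasten2021, §2.4] -/
theorem wronskian_swap (ψ : ℕ → ℤ) (a b : ℕ) : wronskian ψ b a = -wronskian ψ a b := by
  unfold wronskian
  ring

/-- Core of the two-prime construction: for coprime positive `a, b` with `c = a + b` and a prime
`p ∣ b`, the derivation `ψ(ξ_p) = (c/q) v_q(c)`, `ψ(ξ_q) = (b/p) v_p(b)` (for a prime `q ∣ c`)
lies in `𝒯(a,b)`, makes `a, b` `ψ`-independent and has `‖ψ‖ ≤ ω(abc)/(2 log 2) · c log c`.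
[cite: Pasten2021, Lemma 3.5 and Example 3.6] -/
theorem exists_adapted_independent_of_prime_dvd {a b c p : ℕ} (ha : 0 < a) (hb : 0 < b)
    (hc : a + b = c) (hab : Nat.Coprime a b) (hp : p.Prime) (hpb : p ∣ b) :
    ∃ ψ : ℕ → ℤ, IsAdapted ψ a b ∧ wronskian ψ a b ≠ 0 ∧
      ∀ r : ℕ, (|ψ r| : ℝ) ≤ ((a * b * c).primeFactors.card : ℝ) / (2 * Real.log 2) *
        ((c : ℝ) * Real.log (c : ℝ)) := by
  have hc0 : c ≠ 0 := by omega
  have hcpos : 0 < c := by omega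
  have hbc : b ≤ c := by omega
  obtain ⟨q, hq, hqc⟩ := Nat.exists_prime_and_dvd (show c ≠ 1 by omega)
  -- coprimality bookkeeping: `a, b, c` are pairwise coprime
  have hac : Nat.Coprime a c := by rw [← hc]; exact Nat.coprime_self_add_right.mpr hab
  have hbc' : Nat.Coprime b c := by rw [← hc]; exact Nat.coprime_add_self_right.mpr hab.symm
  have hpa : ¬ p ∣ a := fun h =>
    hp.one_lt.ne' (Nat.Coprime.eq_one_of_dvd (Nat.Coprime.coprime_dvd_left h hab) hpb)
  have hpc : ¬ p ∣ c := fun h =>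
    hp.one_lt.ne' (Nat.Coprime.eq_one_of_dvd (Nat.Coprime.coprime_dvd_left hpb hbc') h)
  have hqa : ¬ q ∣ a := fun h =>
    hq.one_lt.ne' (Nat.Coprime.eq_one_of_dvd (Nat.Coprime.coprime_dvd_left h hac) hqc)
  have hqb : ¬ q ∣ b := fun h =>
    hq.one_lt.ne' (Nat.Coprime.eq_one_of_dvd (Nat.Coprime.coprime_dvd_left h hbc') hqc)
  have hpq : p ≠ q := fun h => hpc (h ▸ hqc)
  have habc0 : a * b * c ≠ 0 := mul_ne_zero (mul_ne_zero ha.ne' hb.ne') hc0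
  -- the two values of `ψ`
  obtain ⟨X, hX⟩ : ∃ X : ℕ, X = c / q * c.factorization q := ⟨_, rfl⟩
  obtain ⟨Y, hY⟩ : ∃ Y : ℕ, Y = b / p * b.factorization p := ⟨_, rfl⟩
  have hXpos : 0 < X := by
    rw [hX]
    exact Nat.mul_pos (Nat.div_pos (Nat.le_of_dvd hcpos hqc) hq.pos)
      (hq.factorization_pos_of_dvd hc0 hqc)
  have hvp : 0 < b.factorization p := hp.factorization_pos_of_dvd hb.ne' hpb
  let ψ : ℕ → ℤ := fun r => if r = p then (X : ℤ) else if r = q then (Y : ℤ) else 0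
  have hψp : ψ p = X := by simp [ψ]
  have hψq : ψ q = Y := by simp [ψ, hpq.symm]
  have hψ0 : ∀ r, r ≠ p → r ≠ q → ψ r = 0 := fun r h1 h2 => by simp [ψ, h1, h2]
  have hψnn : ∀ r, 0 ≤ ψ r := by
    intro r
    by_cases h1 : r = p
    · rw [h1, hψp]; positivity
    by_cases h2 : r = q
    · rw [h2, hψq]; positivity
    rw [hψ0 r h1 h2]
  -- the three arithmetic derivatives
  have hda : arithDerivWith ψ a = 0 := by
    rw [arithDerivWith_eq_single ψ a p]
    · rw [Nat.factorization_eq_zero_of_not_dvd hpa]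
      simp
    · intro r _ hra hrp
      exact hψ0 r hrp (fun h => hqa (h ▸ hra))
  have hdb : arithDerivWith ψ b = (b : ℚ) * ((b.factorization p : ℚ) * (X : ℚ) / (p : ℚ)) := by
    rw [arithDerivWith_eq_single ψ b p]
    · rw [hψp]
      push_cast
      ring
    · intro r _ hrb hrp
      exact hψ0 r hrp (fun h => hqb (h ▸ hrb))
  have hdc : arithDerivWith ψ c = (c : ℚ) * ((c.factorization q : ℚ) * (Y : ℚ) / (q : ℚ)) := by
    rw [arithDerivWith_eq_single ψ c q]
    · rw [hψq]
      push_cast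
      ring
    · intro r _ hrc hrq
      exact hψ0 r (fun h => hpc (h ▸ hrc)) hrq
  -- casts of the exact quotients
  have hXq : ((c / q : ℕ) : ℚ) * (q : ℚ) = (c : ℚ) := by exact_mod_cast Nat.div_mul_cancel hqc
  have hYp : ((b / p : ℕ) : ℚ) * (p : ℚ) = (b : ℚ) := by exact_mod_cast Nat.div_mul_cancel hpb
  have hp0 : (p : ℚ) ≠ 0 := by exact_mod_cast hp.ne_zero
  have hq0 : (q : ℚ) ≠ 0 := by exact_mod_cast hq.ne_zero
  refine ⟨ψ, ⟨?_, ?_⟩, ?_, ?_⟩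
  · -- support ⊆ primes of `abc`
    intro r hr
    rw [hc]
    by_cases hrp : r = p
    · rw [hrp]
      exact ⟨hp, (hpb.mul_left a).mul_right c⟩
    by_cases hrq : r = q
    · rw [hrq]
      exact ⟨hq, hqc.mul_left (a * b)⟩
    exact absurd (hψ0 r hrp hrq) hr
  · -- additivity on `a + b = c`
    rw [hc, hdc, hda, hdb, zero_add, hX, hY]
    push_cast
    rw [← hXq, ← hYp]
    field_simp
  · -- independence: `W^ψ(a,b) = a · d^ψ b ≠ 0`
    rw [wronskian, hda, hdb, mul_zero, sub_zero]
    have ha' : (0 : ℚ) < a := by exact_mod_cast ha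
    have hb' : (0 : ℚ) < b := by exact_mod_cast hb
    have hX' : (0 : ℚ) < X := by exact_mod_cast hXpos
    have hv' : (0 : ℚ) < b.factorization p := by exact_mod_cast hvp
    have hp' : (0 : ℚ) < p := by exact_mod_cast hp.pos
    positivity
  · -- the norm bound
    intro r
    have hlog2 : 0 < Real.log 2 := Real.log_pos one_lt_two
    have hc1 : (1 : ℝ) ≤ c := by exact_mod_cast hcpos
    have hb1 : (1 : ℝ) ≤ b := by exact_mod_cast hb
    have hlogc : 0 ≤ Real.log c := Real.log_nonneg hc1
    have hcl : 0 ≤ (c : ℝ) * Real.log c := mul_nonneg (Nat.cast_nonneg _) hlogc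
    have hn2 : 2 ≤ (a * b * c).primeFactors.card := by
      have hsub : ({p, q} : Finset ℕ) ⊆ (a * b * c).primeFactors := by
        intro r hr
        simp only [Finset.mem_insert, Finset.mem_singleton] at hr
        rw [Nat.mem_primeFactors]
        rcases hr with rfl | rfl
        · exact ⟨hp, (hpb.mul_left a).mul_right c, habc0⟩
        · exact ⟨hq, hqc.mul_left (a * b), habc0⟩
      calc 2 = ({p, q} : Finset ℕ).card := (Finset.card_pair hpq).symm
        _ ≤ _ := Finset.card_le_card hsub
    have hn2' : (2 : ℝ) ≤ ((a * b * c).primeFactors.card : ℝ) := by exact_mod_cast hn2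
    -- step 1: `|ψ r| ≤ c log c / log 2`
    have habs : (|ψ r| : ℝ) = ((ψ r : ℤ) : ℝ) := by
      rw [← Int.cast_abs, abs_of_nonneg (hψnn r)]
    have hA : ((ψ r : ℤ) : ℝ) ≤ (c : ℝ) * Real.log c / Real.log 2 := by
      by_cases hrp : r = p
      · rw [hrp, hψp, Int.cast_natCast, hX]
        exact cast_div_mul_factorization_le hc0 hq.two_le
      by_cases hrq : r = q
      · rw [hrq, hψq, Int.cast_natCast, hY]
        calc ((b / p * b.factorization p : ℕ) : ℝ) ≤ (b : ℝ) * Real.log b / Real.log 2 :=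
              cast_div_mul_factorization_le hb.ne' hp.two_le
          _ ≤ (c : ℝ) * Real.log c / Real.log 2 := by
              have hbc'' : (b : ℝ) ≤ c := by exact_mod_cast hbc
              have hlogbc : Real.log b ≤ Real.log c := Real.log_le_log (by positivity) hbc''
              have hlogb : 0 ≤ Real.log b := Real.log_nonneg hb1
              exact div_le_div_of_nonneg_right
                (mul_le_mul hbc'' hlogbc hlogb (Nat.cast_nonneg _)) hlog2.le
      rw [hψ0 r hrp hrq, Int.cast_zero]
      positivity
    -- step 2: `c log c / log 2 = 2/(2 log 2) · c log c ≤ ω(abc)/(2 log 2) · c log c`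
    rw [habs]
    calc ((ψ r : ℤ) : ℝ) ≤ (c : ℝ) * Real.log c / Real.log 2 := hA
      _ = 2 / (2 * Real.log 2) * ((c : ℝ) * Real.log c) := by
          field_simp
      _ ≤ ((a * b * c).primeFactors.card : ℝ) / (2 * Real.log 2) * ((c : ℝ) * Real.log c) := by
          gcongr

/-- **Discharge of `exists_adapted_independent`** (Pasten, Lemma 3.5: small arithmetic derivatives
satisfying independence exist unconditionally, `‖ψ‖ ≤ ω(abc)/(2 log 2) · c log c`). Proved by the
explicit two-prime derivation of Example 3.6 rather than by Siegel's lemma (Theorem 2.6); see the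
module docstring. [cite: Pasten2021, Lemma 3.5, Thm. 2.6 and Example 3.6] -/
theorem exists_adapted_independent_holds : exists_adapted_independent := by
  intro a b ht hne
  obtain ⟨ha, hb, -, hab⟩ := ht
  by_cases hb1 : b = 1
  · subst hb1
    have ha1 : a ≠ 1 := fun h => hne (by rw [h])
    obtain ⟨p, hp, hpa⟩ := Nat.exists_prime_and_dvd ha1
    obtain ⟨ψ, hψ, hW, hbound⟩ :=
      exists_adapted_independent_of_prime_dvd (a := 1) (b := a) (c := a + 1) Nat.one_pos ha
        (add_comm 1 a) (Nat.coprime_one_left a) hp hpa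
    refine ⟨ψ, hψ.symm, ?_, ?_⟩
    · rw [wronskian_swap]
      exact neg_ne_zero.mpr hW
    · intro r
      have h := hbound r
      rw [one_mul] at h
      rw [mul_one]
      exact h
  · obtain ⟨p, hp, hpb⟩ := Nat.exists_prime_and_dvd hb1
    exact exists_adapted_independent_of_prime_dvd ha hb rfl hab hp hpb

end Literature.Barriers.ABC.Pasten
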